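import Mathlib
import Summits.ValiantsHypothesis.ValiantsHypothesis.Theorems.DivisionGapPerMultiplesHardDeepPureCount
import Summits.ValiantsHypothesis.ValiantsHypothesis.Theorems.DivisionGapPerMultiplesHardRelDenseCompleteClass
import Summits.ValiantsHypothesis.ValiantsHypothesis.Theorems.DivisionGapPerMultiplesHardThinPatterns
import Summits.ValiantsHypothesis.ValiantsHypothesis.Theorems.DivisionGapPerMultiplesHardPushOff
import Literature.Computability.AlgebraicComplexity.ArithCircuitProofs
import Literature.Computability.AlgebraicComplexity.PermanentIrreducible

/-!
# `DivisionGap.PerMultiplesHard` (stmt-ValiantsHypothesis-5068), line `uncharged-face-walk`: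
stub `stub_richHostConstantMarginsRaw` — rich host + complete class with CONSTANT margins, raw form

Let `per_G := Σ_{σ inside G} x^{μ_σ}` be the face permanent of a host `G ⊆ [n]²` (cells
`(row, column)`; `σ` is inside `G` when `(σ i, i) ∈ G` for every column `i`), and let the
cofactor `t ∈ ℝ≥0[x_ij]` have ALL row and column margins equal to `q ≥ 1` and contain `q • μ_π`
in its support for every permutation `π` inside `G`.  Then for `3^{(D+2)²} ≤ n`

  `#PM(G) · 3^{D n} ≤ (L(per_G · t) + 1)^{3^{(D+1)²}} · n! · (n+1)^{3^{(D+1)²}} · 2^{D(n − ⌊n/3⌋) + 3^{(D+2)²}}`.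

Proof (composition of tree theorems of the line).
* `g := per_G · t` has all row and column margins `q + 1`
  (`RelDenseCompleteClass.margins_facePer_mul` with constant margins).
* For `π` inside `G`, the probe `μ_π + q • μ_π ∈ supp g` (`ThinPatterns.add_mem_support_mul` with
  `PushOff.mem_support_facePer` and the hypothesis `q • μ_π ∈ supp t`); it is PURE (supported
  inside the graph `{(π j, j)}` of `π`), and `π ↦ μ_π + q • μ_π` is injective, so
  `#PM(G) ≤ #pure(g)` (`Finset.card_le_card_of_injOn`).
* `DeepPureCount.deepPureCount D n _ (q + 1) _ g _` bounds `#pure(g) · 3^{D n}`.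
-/

noncomputable section

-- `Summit.ValiantsHypothesis.ValiantsHypothesis.…` is the tree's mandated layout (Sub = Summit).
set_option linter.dupNamespace false

namespace Summit.ValiantsHypothesis.ValiantsHypothesis.Theorems.DivisionGap.PerMultiplesHard.RichHostConstantMarginsRaw

open MvPolynomial Literature.Computability.AlgebraicComplexity
open scoped NNReal BigOperators

/-! ### The probe exponent `μ_π + q • μ_π` -/

/-- The probe exponent `μ_π + q • μ_π` read cellwise: `q + 1` on the cells `(π j, j)`, `0`
elsewhere. [folklore] -/
theorem probe_apply {n : ℕ} (π : Equiv.Perm (Fin n)) (q : ℕ) (i j : Fin n) :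
    (permMonomial π + q • permMonomial π) (i, j) = if π j = i then q + 1 else 0 := by
  simp only [Finsupp.coe_add, Finsupp.coe_smul, Pi.add_apply, Pi.smul_apply, smul_eq_mul,
    permMonomial_apply]
  split_ifs
  · ring
  · rfl

/-- The probe exponent `μ_π + q • μ_π` is pure: it is supported inside the graph `{(π j, j)}`
of `π`. [folklore] -/
theorem probe_pure {n : ℕ} (π : Equiv.Perm (Fin n)) (q : ℕ) :
    ∀ e ∈ (permMonomial π + q • permMonomial π).support, e.1 = π e.2 := by
  rintro ⟨i, j⟩ he
  rw [Finsupp.mem_support_iff, probe_apply] at he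
  by_contra h
  exact he (if_neg fun h' => h h'.symm)

/-- `π ↦ μ_π + q • μ_π` is injective (read the cell `(π c, c)`). [folklore] -/
theorem probe_injective {n : ℕ} (q : ℕ) :
    Function.Injective (fun π : Equiv.Perm (Fin n) => permMonomial π + q • permMonomial π) := by
  intro π π' h
  have h' : permMonomial π + q • permMonomial π = permMonomial π' + q • permMonomial π' := h
  refine Equiv.ext fun c => ?_
  have hc := DFunLike.congr_fun h' (π c, c)
  rw [probe_apply, probe_apply, if_pos rfl] at hc
  by_contra hne
  rw [if_neg fun h'' => hne h''.symm] at hc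
  exact Nat.succ_ne_zero q hc

/-! ### The stub -/

/-- **stub_richHostConstantMarginsRaw — rich host + complete class with CONSTANT margins, raw
closed form.**  For `3^{(D+2)²} ≤ n`, a host `G ⊆ [n]²`, `q ≥ 1` and a cofactor `t ∈ ℝ≥0[x_ij]`
all of whose exponents have all row and column margins `q` and whose support contains `q • μ_π`
for every permutation `π` inside `G`:
`#PM(G) · 3^{D n} ≤ (L(per_G · t) + 1)^{3^{(D+1)²}} · n! · (n+1)^{3^{(D+1)²}} · 2^{D(n − ⌊n/3⌋) + 3^{(D+2)²}}`.
Proof: `per_G · t` has all margins `q + 1` (`RelDenseCompleteClass.margins_facePer_mul`); every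
`π` inside `G` yields the pure exponent `μ_π + q • μ_π` of `per_G · t`
(`ThinPatterns.add_mem_support_mul`, `PushOff.mem_support_facePer`), injectively in `π`, so
`#PM(G) ≤ #pure(per_G · t)`; conclude with `DeepPureCount.deepPureCount` at margin `q + 1`.
[cite: JerrumSnir1982, §3–4] -/
theorem stub_richHostConstantMarginsRaw :
    ∀ (D n : ℕ), 3 ^ ((D + 2) ^ 2) ≤ n →
      ∀ (G : Finset (Fin n × Fin n)) (t : MvPolynomial (Fin n × Fin n) ℝ≥0) (q : ℕ), 1 ≤ q →
      (∀ m ∈ t.support, (∀ i, ∑ j, m (i, j) = q) ∧ (∀ j, ∑ i, m (i, j) = q)) →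
      (∀ π : Equiv.Perm (Fin n), (∀ i, (π i, i) ∈ G) → q • permMonomial π ∈ t.support) →
      ((Finset.univ : Finset (Equiv.Perm (Fin n))).filter (fun σ => ∀ i, (σ i, i) ∈ G)).card * 3 ^ (D * n) ≤
        (complexity ((∑ σ ∈ (Finset.univ : Finset (Equiv.Perm (Fin n))).filter (fun σ => ∀ i, (σ i, i) ∈ G),
            monomial (permMonomial σ) (1 : ℝ≥0)) * t) + 1) ^ (3 ^ ((D + 1) ^ 2)) *
          (n.factorial * ((n + 1) ^ (3 ^ ((D + 1) ^ 2)) * 2 ^ (D * (n - n / 3) + 3 ^ ((D + 2) ^ 2)))) := by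
  classical
  intro D n hn G t q _hq ht hπ
  -- (1) `per_G · t` has all row and column margins `q + 1`
  have hmarg := RelDenseCompleteClass.margins_facePer_mul G (r := fun _ => q) (cc := fun _ => q) ht
  -- (4) the deep pure count at margin `q + 1`
  have hdeep := DeepPureCount.deepPureCount D n hn (q + 1) (Nat.le_add_left 1 q) _ hmarg
  refine le_trans (Nat.mul_le_mul_right _ ?_) hdeep
  -- (2)+(3) `π ↦ μ_π + q • μ_π` injects the permutations inside `G` into the pure exponents
  refine Finset.card_le_card_of_injOn (fun π => permMonomial π + q • permMonomial π) ?_ ?_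
  · intro π hπG
    have hπG' : ∀ i, (π i, i) ∈ G := (Finset.mem_filter.1 (Finset.mem_coe.1 hπG)).2
    refine Finset.mem_coe.2 (Finset.mem_filter.2 ⟨?_, π, probe_pure π q⟩)
    exact ThinPatterns.add_mem_support_mul (PushOff.mem_support_facePer.2 ⟨π, hπG', rfl⟩)
      (hπ π hπG')
  · intro π _ π' _ h
    exact probe_injective q h

end Summit.ValiantsHypothesis.ValiantsHypothesis.Theorems.DivisionGap.PerMultiplesHard.RichHostConstantMarginsRaw
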